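import Summits.ResolutionOfSingularities.ResolutionOfSingularities.Theorems.UniversalCellsDefs

/-!
# Torus splitting for the affine chart `p_123 ≠ 0` of `Gr(3, 3+m)` (Gelfand–MacPherson)

Support file for crux stmt-ResolutionOfSingularities-15234 (`UniversalCells.Universality`, line
`birth`): stub `stub_torusSplitting`.  With `κ = Unit ⊕ κ'` (frame column `F = inl ()`, the other
columns `c : κ'` with designated rows `d c`), the partial matroid stratum ring
`S = 𝔽_p[a_ij] ⧸ ⟨Γ₀-minors of [I₃ | A]⟩ [1/D]` (`D = ∏ designated minors = ± ∏ a_{iF} ∏ a_{dc,c}`)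
is isomorphic to the Laurent polynomial ring `L = Nr[λ_i^±, μ_c^±]` over the normalised stratum
ring `Nr = 𝔽_p[n_ic] ⧸ ⟨n_{dc,c} − 1, Γ₀-minors of [I₃ | 𝟙 | n]⟩` (Hu, arXiv:2109.02968, Thm. 9.3,
p. 64; Lafforgue 2003, Thm. I.11).

Everything rests on one determinant identity (`det_submatrix_scale`, `exists_unit_factor`): if
`a_{iF} = l_i` and `a_{ic} = l_i m_c n_ic` with units `l_i`, `m_c`, then
`[I₃ | A] = diag(l) · [I₃ | 𝟙 | n] · diag(l⁻¹ ⊕ 1 ⊕ m)`, so corresponding `3 × 3` column-minors of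
`[I₃ | A]` and `[I₃ | 𝟙 | n]` differ by a unit.  Hence `Φ : S → L`, `a_{iF} ↦ λ_i`,
`a_{ic} ↦ λ_i μ_c n_ic` (`exists_Phi`) kills the `Γ₀`-minors and inverts the designated minors
`± a_{iF}`, `± a_{dc,c}` (`minor'_entrySel`); and `Ψ : L → S`, `λ_i ↦ a_{iF}`,
`μ_c ↦ μ̂_c := a_{dc,c} / a_{dc,F}`, `n_ic ↦ a_ic / (a_iF μ̂_c)` (`exists_Psi`; the frame and
designated entries are units in `S`, `units_S`) kills `n_{dc,c} − 1` and the `Γ₀`-minors of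
`[I₃ | 𝟙 | n]`.  The composites fix generators, so they are the identity (`ringHom_ext_S`,
`ringHom_ext_L`, `nonempty_ringEquiv`).  If `Γ₀` contains a designated selector both rings are
trivial; the argument does not distinguish this case.  No definition is declared: the maps enter
the lemmas through their values on generators.
-/

-- single-problem summit: the doubled namespace component `ResolutionOfSingularities` is forced
set_option linter.dupNamespace false

noncomputable section

namespace Summit.ResolutionOfSingularities.ResolutionOfSingularities.Theorems.UniversalCells

namespace TorusSplitting

open MvPolynomial

/-! ### Determinant bookkeeping -/

/-- Scaling rows by `l` and columns by `s` scales every `3 × 3` column-minor by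
`(∏ l) · ∏ⱼ s (u j)`. [folklore] -/
theorem det_submatrix_scale {R ι : Type*} [CommRing R] (M : Matrix (Fin 3) ι R) (l : Fin 3 → R)
    (s : ι → R) (u : Fin 3 → ι) :
    ((Matrix.of fun i j => l i * s j * M i j).submatrix id u).det =
      (∏ i, l i) * (∏ j, s (u j)) * (M.submatrix id u).det := by
  simp only [Matrix.det_fin_three, Matrix.submatrix_apply, Matrix.of_apply, id, Fin.prod_univ_three]
  ring

/-- The minor of `[I₃ | N]` on "the two identity columns complementary to row `i`, then column `c`
of `N`" is `± N i c`. [folklore] -/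
theorem det_entrySel {R : Type*} {κ : Type} [CommRing R] (N : Matrix (Fin 3) κ R) (i : Fin 3)
    (c : κ) :
    ((Matrix.fromCols (1 : Matrix (Fin 3) (Fin 3) R) N).submatrix id (entrySel κ i c)).det =
      (-1 : R) ^ (i : ℕ) * N i c := by
  fin_cases i <;> simp [Matrix.det_fin_three, Fin.succAbove]

/-- The designated minors of `[I₃ | A]` are, up to sign, entries of `A`. [folklore] -/
theorem minor'_entrySel (p : ℕ) (κ : Type) (i : Fin 3) (c : κ) :
    minor' p κ (entrySel κ i c) =
      (-1 : MvPolynomial (Fin 3 × κ) (ZMod p)) ^ (i : ℕ) * X (i, c) := by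
  rw [minor', tautMatrix', det_entrySel, Matrix.of_apply]

/-- A ring map `f` sends the minor `minor' u` of `[I₃ | A]` to the corresponding minor of
`[I₃ | f A]`. [folklore] -/
theorem map_minor' {T : Type*} [CommRing T] (p : ℕ) (κ : Type)
    (f : MvPolynomial (Fin 3 × κ) (ZMod p) →+* T) (u : Fin 3 → Fin 3 ⊕ κ) :
    f (minor' p κ u) = ((Matrix.fromCols (1 : Matrix (Fin 3) (Fin 3) T)
      (Matrix.of fun i j => f (X (i, j)))).submatrix id u).det := by
  rw [minor', RingHom.map_det, RingHom.mapMatrix_apply, ← Matrix.submatrix_map, Matrix.fromCols_map,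
    Matrix.map_one f (map_zero f) (map_one f)]
  rfl

/-- A ring map `g` sends the minor `normMinor u` of `[I₃ | 𝟙 | n]` to the corresponding minor of
`[I₃ | 𝟙 | g n]`. [folklore] -/
theorem map_normMinor {T : Type*} [CommRing T] (p : ℕ) (κ' : Type)
    (g : MvPolynomial (Fin 3 × κ') (ZMod p) →+* T) (u : Fin 3 → Fin 3 ⊕ (Unit ⊕ κ')) :
    g (normMinor p κ' u) = ((Matrix.fromCols (1 : Matrix (Fin 3) (Fin 3) T)
      (Matrix.fromCols (Matrix.of fun (_ : Fin 3) (_ : Unit) => (1 : T))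
        (Matrix.of fun i c => g (X (i, c))))).submatrix id u).det := by
  have hmat : (normMatrix p κ').map g = Matrix.fromCols (1 : Matrix (Fin 3) (Fin 3) T)
      (Matrix.fromCols (Matrix.of fun (_ : Fin 3) (_ : Unit) => (1 : T))
        (Matrix.of fun i c => g (X (i, c)))) := by
    rw [normMatrix, Matrix.fromCols_map, Matrix.fromCols_map,
      Matrix.map_one g (map_zero g) (map_one g)]
    congr 2
    ext i j
    exact map_one g
  rw [normMinor, RingHom.map_det, RingHom.mapMatrix_apply, ← Matrix.submatrix_map, hmat]

/-- GELFAND–MACPHERSON FACTORISATION: if the columns of `A` are `a_{·,F} = l` and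
`a_{i c} = l i · m c · n_{i c}` with units `l i`, `m c`, then every `3 × 3` minor of `[I₃ | A]` is a
unit multiple of the corresponding minor of `[I₃ | 𝟙 | n]`
(`[I₃ | A] = diag(l) · [I₃ | 𝟙 | n] · diag(l⁻¹ ⊕ 1 ⊕ m)`). [cite: Hu2021, p. 64] -/
theorem exists_unit_factor {T : Type*} [CommRing T] {κ' : Type} (l : Fin 3 → Tˣ) (m : κ' → Tˣ)
    (n : Fin 3 → κ' → T) (a : Fin 3 → Unit ⊕ κ' → T) (ha₁ : ∀ i, a i (Sum.inl ()) = l i)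
    (ha₂ : ∀ i c, a i (Sum.inr c) = l i * m c * n i c) (u : Fin 3 → Fin 3 ⊕ (Unit ⊕ κ')) :
    ∃ w : Tˣ, ((Matrix.fromCols (1 : Matrix (Fin 3) (Fin 3) T) (Matrix.of a)).submatrix id u).det =
      w * ((Matrix.fromCols (1 : Matrix (Fin 3) (Fin 3) T)
        (Matrix.fromCols (Matrix.of fun (_ : Fin 3) (_ : Unit) => (1 : T))
          (Matrix.of n))).submatrix id u).det := by
  set s : Fin 3 ⊕ (Unit ⊕ κ') → Tˣ := Sum.elim (fun i => (l i)⁻¹) (Sum.elim (fun _ => 1) m) with hs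
  have key : Matrix.fromCols (1 : Matrix (Fin 3) (Fin 3) T) (Matrix.of a) =
      Matrix.of fun i j => (l i : T) * s j * (Matrix.fromCols (1 : Matrix (Fin 3) (Fin 3) T)
        (Matrix.fromCols (Matrix.of fun (_ : Fin 3) (_ : Unit) => (1 : T)) (Matrix.of n))) i j := by
    ext i (k | ⟨⟨⟩ | c⟩)
    · by_cases hik : i = k
      · subst hik
        simp [hs]
      · simp [hs, hik]
    · simp [hs, ha₁]
    · simp [hs, ha₂]
  refine ⟨(∏ i, l i) * ∏ j, s (u j), ?_⟩
  rw [key, det_submatrix_scale, Units.val_mul, Units.coe_prod, Units.coe_prod]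

/-! ### The stratum side `S = 𝔽_p[a_ij][Γ₀-minors = 0][1/D]` -/

/-- Ring maps out of the stratum ring agree once they agree on the entries `a_ij`. [folklore] -/
theorem ringHom_ext_S (p : ℕ) (κ : Type) (Γp : Finset (Fin 3 → Fin 3 ⊕ κ))
    (Γ0 : Set (Fin 3 → Fin 3 ⊕ κ))
    (π : MvPolynomial (Fin 3 × κ) (ZMod p) →+* StratumRing' p κ Γp Γ0)
    (hπ : π = (algebraMap _ _).comp (Ideal.Quotient.mk (Ideal.span (minor' p κ '' Γ0))))
    {T : Type*} [Semiring T] {f g : StratumRing' p κ Γp Γ0 →+* T}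
    (h : ∀ ij, f (π (X ij)) = g (π (X ij))) : f = g := by
  subst hπ
  apply IsLocalization.ringHom_ext (Submonoid.powers
    (Ideal.Quotient.mk (Ideal.span (minor' p κ '' Γ0)) (∏ u ∈ Γp, minor' p κ u)))
  apply Ideal.Quotient.ringHom_ext
  exact MvPolynomial.ringHom_ext' (Subsingleton.elim _ _) h

/-- In the stratum ring the `Γ₀`-minors vanish and the frame entries `a_{iF}` and the designated
entries `a_{d c, c}` are units (each is `±` a designated minor, which divides `D`).
[cite: Hu2021, p. 64] -/
theorem units_S (p : ℕ) (κ' : Type) [Fintype κ'] [DecidableEq κ'] (d : κ' → Fin 3)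
    (Γ0 : Set (Fin 3 → Fin 3 ⊕ (Unit ⊕ κ')))
    (π : MvPolynomial (Fin 3 × (Unit ⊕ κ')) (ZMod p) →+*
      StratumRing' p (Unit ⊕ κ') (designatedSels κ' d) Γ0)
    (hπ : π = (algebraMap _ _).comp (Ideal.Quotient.mk (Ideal.span (minor' p (Unit ⊕ κ') '' Γ0)))) :
    (∀ u ∈ Γ0, π (minor' p (Unit ⊕ κ') u) = 0) ∧ (∀ i, IsUnit (π (X (i, Sum.inl ())))) ∧
      ∀ c, IsUnit (π (X (d c, Sum.inr c))) := by
  -- `D` is a unit in `S = (P ⧸ I)[1/D]`, hence so is every designated minor `± a_ij`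
  have hD : IsUnit (π (∏ u ∈ designatedSels κ' d, minor' p (Unit ⊕ κ') u)) := by
    subst hπ
    rw [RingHom.comp_apply]
    exact IsLocalization.Away.algebraMap_isUnit _
  have hu : ∀ (i : Fin 3) (j : Unit ⊕ κ'), entrySel (Unit ⊕ κ') i j ∈ designatedSels κ' d →
      IsUnit (π (X (i, j))) := by
    intro i j hmem
    have h := isUnit_of_dvd_unit (map_dvd π (Finset.dvd_prod_of_mem (minor' p (Unit ⊕ κ')) hmem)) hD
    rw [minor'_entrySel, map_mul] at h
    exact (IsUnit.mul_iff.1 h).2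
  refine ⟨fun u hu0 => ?_, fun i => hu i _ (Finset.mem_union_left _
    (Finset.mem_image_of_mem _ (Finset.mem_univ i))), fun c => hu _ _ (Finset.mem_union_right _
    (Finset.mem_image_of_mem _ (Finset.mem_univ c)))⟩
  subst hπ
  rw [RingHom.comp_apply, Ideal.Quotient.eq_zero_iff_mem.2
    (Ideal.subset_span (Set.mem_image_of_mem (minor' p (Unit ⊕ κ')) hu0)), map_zero]

/-- THE MAP `Φ : S → T` OUT OF THE STRATUM RING: given units `l i`, `m c` of `T` and a ring map `g`
on `𝔽_p[n_ic]` killing `normIdeal`, the assignment `a_{iF} ↦ l i`, `a_{ic} ↦ l i · m c · g (n_ic)`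
kills the `Γ₀`-minors and inverts the designated minors (`exists_unit_factor`), so it factors
through the stratum ring. [cite: Hu2021, Thm. 9.3, p. 64] -/
theorem exists_Phi (p : ℕ) (κ' : Type) [Fintype κ'] [DecidableEq κ'] (d : κ' → Fin 3)
    (Γ0 : Set (Fin 3 → Fin 3 ⊕ (Unit ⊕ κ')))
    (π : MvPolynomial (Fin 3 × (Unit ⊕ κ')) (ZMod p) →+*
      StratumRing' p (Unit ⊕ κ') (designatedSels κ' d) Γ0)
    (hπ : π = (algebraMap _ _).comp (Ideal.Quotient.mk (Ideal.span (minor' p (Unit ⊕ κ') '' Γ0))))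
    {T : Type*} [CommRing T] (g : MvPolynomial (Fin 3 × κ') (ZMod p) →+* T)
    (hg : ∀ x ∈ normIdeal p κ' d Γ0, g x = 0) {l : Fin 3 → T} {m : κ' → T}
    (hl : ∀ i, IsUnit (l i)) (hm : ∀ c, IsUnit (m c)) :
    ∃ Φ : StratumRing' p (Unit ⊕ κ') (designatedSels κ' d) Γ0 →+* T,
      (∀ i, Φ (π (X (i, Sum.inl ()))) = l i) ∧
        ∀ i c, Φ (π (X (i, Sum.inr c))) = l i * m c * g (X (i, c)) := by
  -- the map on `𝔽_p[a_ij]`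
  let Φ₀ : MvPolynomial (Fin 3 × (Unit ⊕ κ')) (ZMod p) →+* T := eval₂Hom (g.comp C)
    fun ij => Sum.elim (fun _ => l ij.1) (fun c => l ij.1 * m c * g (X (ij.1, c))) ij.2
  have hΦ₀F : ∀ i, Φ₀ (X (i, Sum.inl ())) = l i := fun i => eval₂Hom_X' _ _ _
  have hΦ₀c : ∀ i c, Φ₀ (X (i, Sum.inr c)) = l i * m c * g (X (i, c)) := fun i c =>
    eval₂Hom_X' _ _ _
  -- Gelfand–MacPherson: `Φ₀ (minor u) = unit * g (normMinor u)`
  have hfac : ∀ u, ∃ w : Tˣ, Φ₀ (minor' p (Unit ⊕ κ') u) = w * g (normMinor p κ' u) := by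
    intro u
    obtain ⟨w, hw⟩ := exists_unit_factor (fun i => (hl i).unit) (fun c => (hm c).unit)
      (fun i c => g (X (i, c))) (fun i j => Φ₀ (X (i, j))) hΦ₀F hΦ₀c u
    exact ⟨w, by rw [map_minor', hw, map_normMinor]⟩
  -- so `Φ₀` kills the `Γ₀`-minors
  have hI : ∀ x ∈ Ideal.span (minor' p (Unit ⊕ κ') '' Γ0), Φ₀ x = 0 := by
    have hle : Ideal.span (minor' p (Unit ⊕ κ') '' Γ0) ≤ RingHom.ker Φ₀ := by
      rw [Ideal.span_le]
      rintro _ ⟨u, hu, rfl⟩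
      obtain ⟨w, hw⟩ := hfac u
      rw [SetLike.mem_coe, RingHom.mem_ker, hw, hg _ (Ideal.subset_span (Or.inr ⟨u, hu, rfl⟩)),
        mul_zero]
    exact fun x hx => RingHom.mem_ker.1 (hle hx)
  -- and inverts the designated minors
  have hg1 : ∀ c, g (X (d c, c)) = 1 := fun c => by
    rw [← sub_eq_zero, ← map_one g, ← map_sub]
    exact hg _ (Ideal.subset_span (Or.inl ⟨c, rfl⟩))
  have hD : IsUnit (Ideal.Quotient.lift _ Φ₀ hI (Ideal.Quotient.mk
      (Ideal.span (minor' p (Unit ⊕ κ') '' Γ0))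
        (∏ u ∈ designatedSels κ' d, minor' p (Unit ⊕ κ') u))) := by
    rw [Ideal.Quotient.lift_mk, map_prod, IsUnit.prod_iff]
    intro u hu
    simp only [Finset.mem_union, Finset.mem_image, Finset.mem_univ, true_and] at hu
    rcases hu with ⟨i, rfl⟩ | ⟨c, rfl⟩
    · rw [minor'_entrySel, map_mul, map_pow, map_neg, map_one, hΦ₀F]
      exact (isUnit_neg_one.pow _).mul (hl i)
    · rw [minor'_entrySel, map_mul, map_pow, map_neg, map_one, hΦ₀c, hg1, mul_one]
      exact (isUnit_neg_one.pow _).mul ((hl _).mul (hm _))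
  refine ⟨IsLocalization.Away.lift _ hD, fun i => ?_, fun i c => ?_⟩
  · subst hπ
    rw [RingHom.comp_apply, IsLocalization.Away.lift_eq, Ideal.Quotient.lift_mk, hΦ₀F]
  · subst hπ
    rw [RingHom.comp_apply, IsLocalization.Away.lift_eq, Ideal.Quotient.lift_mk, hΦ₀c]

/-! ### The torus side `L = NormRing[λ_i^±, μ_c^±]` -/

/-- Ring maps out of the torus ring over the normalised stratum ring agree once they agree on the
`n_ic`, the `λ_i` and the `μ_c`. [folklore] -/
theorem ringHom_ext_L (p : ℕ) (κ' : Type) [Fintype κ'] (d : κ' → Fin 3)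
    (Γ0 : Set (Fin 3 → Fin 3 ⊕ (Unit ⊕ κ')))
    (ι : MvPolynomial (Fin 3 ⊕ κ') (NormRing p κ' d Γ0) →+*
      TorusRing (Fin 3 ⊕ κ') (NormRing p κ' d Γ0)) (hι : ι = algebraMap _ _)
    {T : Type*} [Semiring T] {f g : TorusRing (Fin 3 ⊕ κ') (NormRing p κ' d Γ0) →+* T}
    (hn : ∀ ic, f (ι (C (Ideal.Quotient.mk (normIdeal p κ' d Γ0) (X ic)))) =
      g (ι (C (Ideal.Quotient.mk (normIdeal p κ' d Γ0) (X ic)))))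
    (ht : ∀ t, f (ι (X t)) = g (ι (X t))) : f = g := by
  subst hι
  apply IsLocalization.ringHom_ext (Submonoid.powers
    (∏ t : Fin 3 ⊕ κ', (X t : MvPolynomial (Fin 3 ⊕ κ') (NormRing p κ' d Γ0))))
  refine MvPolynomial.ringHom_ext' ?_ ht
  apply Ideal.Quotient.ringHom_ext
  exact MvPolynomial.ringHom_ext' (Subsingleton.elim _ _) hn

/-- In the torus ring the `λ_i`, `μ_c` are units, and the coefficient map from `𝔽_p[n_ic]` kills
`normIdeal`, in particular `n_{d c, c} = 1`. [folklore] -/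
theorem units_L (p : ℕ) (κ' : Type) [Fintype κ'] (d : κ' → Fin 3)
    (Γ0 : Set (Fin 3 → Fin 3 ⊕ (Unit ⊕ κ')))
    (ι : MvPolynomial (Fin 3 ⊕ κ') (NormRing p κ' d Γ0) →+*
      TorusRing (Fin 3 ⊕ κ') (NormRing p κ' d Γ0)) (hι : ι = algebraMap _ _) :
    (∀ t, IsUnit (ι (X t))) ∧
      (∀ x ∈ normIdeal p κ' d Γ0,
        (ι.comp (C.comp (Ideal.Quotient.mk (normIdeal p κ' d Γ0)))) x = 0) ∧
        ∀ c, ι (C (Ideal.Quotient.mk (normIdeal p κ' d Γ0) (X (d c, c)))) = 1 := by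
  refine ⟨fun t => ?_, fun x hx => ?_, fun c => ?_⟩
  · subst hι
    exact isUnit_of_dvd_unit (map_dvd _ (Finset.dvd_prod_of_mem _ (Finset.mem_univ t)))
      (IsLocalization.Away.algebraMap_isUnit _)
  · simp [Ideal.Quotient.eq_zero_iff_mem.2 hx]
  · have h1 : Ideal.Quotient.mk (normIdeal p κ' d Γ0) (X (d c, c)) = 1 := by
      rw [← map_one (Ideal.Quotient.mk (normIdeal p κ' d Γ0)), Ideal.Quotient.eq]
      exact Ideal.subset_span (Or.inl ⟨c, rfl⟩)
    rw [h1, map_one, map_one]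

/-- THE MAP `Ψ : L → S` OUT OF THE TORUS RING: given a ring map `π` on `𝔽_p[a_ij]` killing the
`Γ₀`-minors and inverting the frame entries `a_{iF}` and the designated entries `a_{d c, c}`, the
assignment `λ_i ↦ a_{iF}`, `μ_c ↦ a_{dc,c} / a_{dc,F}`, `n_ic ↦ a_ic a_{dc,F} / (a_iF a_{dc,c})`
kills `normIdeal` (`exists_unit_factor`) and inverts `∏ λ_i · ∏ μ_c`, so it factors through the
torus ring over the normalised stratum ring. [cite: Hu2021, Thm. 9.3, p. 64] -/
theorem exists_Psi (p : ℕ) (κ' : Type) [Fintype κ'] (d : κ' → Fin 3)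
    (Γ0 : Set (Fin 3 → Fin 3 ⊕ (Unit ⊕ κ')))
    (ι : MvPolynomial (Fin 3 ⊕ κ') (NormRing p κ' d Γ0) →+*
      TorusRing (Fin 3 ⊕ κ') (NormRing p κ' d Γ0)) (hι : ι = algebraMap _ _)
    {S : Type*} [CommRing S] (π : MvPolynomial (Fin 3 × (Unit ⊕ κ')) (ZMod p) →+* S)
    (h0 : ∀ u ∈ Γ0, π (minor' p (Unit ⊕ κ') u) = 0) (hF : ∀ i, IsUnit (π (X (i, Sum.inl ()))))
    (hdes : ∀ c, IsUnit (π (X (d c, Sum.inr c)))) :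
    ∃ Ψ : TorusRing (Fin 3 ⊕ κ') (NormRing p κ' d Γ0) →+* S,
      (∀ i, Ψ (ι (X (Sum.inl i))) = π (X (i, Sum.inl ()))) ∧
      (∀ c, Ψ (ι (X (Sum.inr c))) * π (X (d c, Sum.inl ())) = π (X (d c, Sum.inr c))) ∧
        ∀ i c, π (X (i, Sum.inl ())) * Ψ (ι (X (Sum.inr c))) *
          Ψ (ι (C (Ideal.Quotient.mk (normIdeal p κ' d Γ0) (X (i, c))))) =
            π (X (i, Sum.inr c)) := by
  -- the units `a_{iF}`, `a_{dc,c}`, `μ̂_c := a_{dc,c} / a_{dc,F}` and the entries `n̂_ic`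
  let lS : Fin 3 → Sˣ := fun i => (hF i).unit
  let aD : κ' → Sˣ := fun c => (hdes c).unit
  let mS : κ' → Sˣ := fun c => (lS (d c))⁻¹ * aD c
  let nS : Fin 3 → κ' → S := fun i c => ↑(lS i * mS c)⁻¹ * π (X (i, Sum.inr c))
  have hn : ∀ i c, (lS i : S) * mS c * nS i c = π (X (i, Sum.inr c)) := fun i c => by
    show (lS i : S) * mS c * (↑(lS i * mS c)⁻¹ * π (X (i, Sum.inr c))) = _
    rw [← Units.val_mul, Units.mul_inv_cancel_left]
  have hnd : ∀ c, nS (d c) c = 1 := fun c => by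
    show (↑(lS (d c) * ((lS (d c))⁻¹ * aD c))⁻¹ : S) * π (X (d c, Sum.inr c)) = 1
    rw [mul_inv_cancel_left]
    exact Units.inv_mul (aD c)
  -- the map on `𝔽_p[n_ic]`
  let Ψ₀ : MvPolynomial (Fin 3 × κ') (ZMod p) →+* S := eval₂Hom (π.comp C) fun ic => nS ic.1 ic.2
  have hΨ₀ : ∀ i c, Ψ₀ (X (i, c)) = nS i c := fun i c => eval₂Hom_X' _ _ _
  -- Gelfand–MacPherson: `π (minor u) = unit * Ψ₀ (normMinor u)`, so `Ψ₀` kills `normIdeal`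
  have hfac : ∀ u, ∃ w : Sˣ, π (minor' p (Unit ⊕ κ') u) = w * Ψ₀ (normMinor p κ' u) := by
    intro u
    obtain ⟨w, hw⟩ := exists_unit_factor lS mS nS (fun i j => π (X (i, j))) (fun _ => rfl)
      (fun i c => (hn i c).symm) u
    refine ⟨w, ?_⟩
    rw [map_minor', hw, map_normMinor]
    simp only [hΨ₀]
  have hJ : ∀ x ∈ normIdeal p κ' d Γ0, Ψ₀ x = 0 := by
    have hle : normIdeal p κ' d Γ0 ≤ RingHom.ker Ψ₀ := by
      rw [Ideal.span_le]
      rintro _ (⟨c, rfl⟩ | ⟨u, hu, rfl⟩)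
      · rw [SetLike.mem_coe, RingHom.mem_ker, map_sub, map_one, hΨ₀, hnd, sub_self]
      · obtain ⟨w, hw⟩ := hfac u
        rw [SetLike.mem_coe, RingHom.mem_ker, ← w.mul_right_eq_zero, ← hw]
        exact h0 u hu
    exact fun x hx => RingHom.mem_ker.1 (hle hx)
  -- the map on `NormRing[λ, μ]` and its extension to the torus ring
  let Ψ₁ : NormRing p κ' d Γ0 →+* S := Ideal.Quotient.lift _ Ψ₀ hJ
  have hΨ₁ : ∀ x, Ψ₁ (Ideal.Quotient.mk _ x) = Ψ₀ x := fun x => Ideal.Quotient.lift_mk _ _ _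
  let Ψ₂ : MvPolynomial (Fin 3 ⊕ κ') (NormRing p κ' d Γ0) →+* S :=
    eval₂Hom Ψ₁ (Sum.elim (fun i => (lS i : S)) (fun c => (mS c : S)))
  have hΨ₂l : ∀ i, Ψ₂ (X (Sum.inl i)) = lS i := fun i => eval₂Hom_X' _ _ _
  have hΨ₂m : ∀ c, Ψ₂ (X (Sum.inr c)) = mS c := fun c => eval₂Hom_X' _ _ _
  have hΨ₂C : ∀ r, Ψ₂ (C r) = Ψ₁ r := fun r => eval₂Hom_C _ _ _
  have hunit : IsUnit (Ψ₂ (∏ t : Fin 3 ⊕ κ',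
      (X t : MvPolynomial (Fin 3 ⊕ κ') (NormRing p κ' d Γ0)))) := by
    rw [map_prod, IsUnit.prod_iff]
    rintro (i | c) -
    · rw [hΨ₂l]; exact Units.isUnit _
    · rw [hΨ₂m]; exact Units.isUnit _
  refine ⟨IsLocalization.Away.lift _ hunit, fun i => ?_, fun c => ?_, fun i c => ?_⟩ <;> subst hι
  · rw [IsLocalization.Away.lift_eq, hΨ₂l]
    rfl
  · rw [IsLocalization.Away.lift_eq, hΨ₂m]
    show ((mS c : Sˣ) : S) * lS (d c) = aD c
    rw [← Units.val_mul, inv_mul_cancel_comm]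
  · rw [IsLocalization.Away.lift_eq, IsLocalization.Away.lift_eq, hΨ₂m, hΨ₂C, hΨ₁, hΨ₀]
    exact hn i c

/-! ### Assembly -/

/-- Two ring maps that are inverse to each other on generators, granted the extensionality
principles of both sides, assemble to a ring isomorphism. [folklore] -/
theorem nonempty_ringEquiv {κ' : Type} (d : κ' → Fin 3) {S L : Type*} [CommRing S] [CommRing L]
    {aF : Fin 3 → S} {a : Fin 3 → κ' → S} {lam : Fin 3 → L} {mu : κ' → L} {nu : Fin 3 → κ' → L}
    (hextS : ∀ f g : S →+* S, (∀ i, f (aF i) = g (aF i)) → (∀ i c, f (a i c) = g (a i c)) → f = g)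
    (hextL : ∀ f g : L →+* L, (∀ i c, f (nu i c) = g (nu i c)) → (∀ i, f (lam i) = g (lam i)) →
      (∀ c, f (mu c) = g (mu c)) → f = g)
    (hlam : ∀ i, IsUnit (lam i)) (hmu : ∀ c, IsUnit (mu c)) (hnu : ∀ c, nu (d c) c = 1)
    {Φ : S →+* L} {Ψ : L →+* S} (hΦF : ∀ i, Φ (aF i) = lam i)
    (hΦc : ∀ i c, Φ (a i c) = lam i * mu c * nu i c) (hΨ1 : ∀ i, Ψ (lam i) = aF i)
    (hΨ2 : ∀ c, Ψ (mu c) * aF (d c) = a (d c) c)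
    (hΨ3 : ∀ i c, aF i * Ψ (mu c) * Ψ (nu i c) = a i c) : Nonempty (S ≃+* L) := by
  have hμ : ∀ c, Φ (Ψ (mu c)) = mu c := fun c => by
    have h := congr_arg Φ (hΨ2 c)
    rw [map_mul, hΦF, hΦc, hnu, mul_one] at h
    exact (hlam _).mul_right_cancel (h.trans (mul_comm _ _))
  have hν : ∀ i c, Φ (Ψ (nu i c)) = nu i c := fun i c => by
    have h := congr_arg Φ (hΨ3 i c)
    rw [map_mul, map_mul, hΦF, hμ, hΦc] at h
    exact ((hlam _).mul (hmu _)).mul_left_cancel h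
  refine ⟨RingEquiv.ofRingHom Φ Ψ ?_ ?_⟩
  · refine hextL _ _ (fun i c => ?_) (fun i => ?_) (fun c => ?_)
    · rw [RingHom.comp_apply, RingHom.id_apply, hν]
    · rw [RingHom.comp_apply, RingHom.id_apply, hΨ1, hΦF]
    · rw [RingHom.comp_apply, RingHom.id_apply, hμ]
  · refine hextS _ _ (fun i => ?_) (fun i c => ?_)
    · rw [RingHom.comp_apply, RingHom.id_apply, hΦF, hΨ1]
    · rw [RingHom.comp_apply, RingHom.id_apply, hΦc, map_mul, map_mul, hΨ1, hΨ3]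

end TorusSplitting

/-- **TORUS SPLITTING** (Gelfand–MacPherson for the affine chart `p_123 ≠ 0` of `Gr(3, 3+m)`): the
coordinate ring of the partial matroid stratum with the frame entries `a_{iF}` and the designated
entries `a_{d c, c}` inverted is the Laurent polynomial ring in `λ_1, λ_2, λ_3, μ_c` over the
NORMALISED stratum ring `𝔽_p[n_ic] ⧸ ⟨n_{dc,c} − 1, Γ₀-minors of [I₃ | 𝟙 | n]⟩`.  The isomorphism is
`a_{iF} ↦ λ_i`, `a_{ic} ↦ λ_i μ_c n_ic` (`exists_Phi`) with inverse `λ_i ↦ a_{iF}`,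
`μ_c ↦ a_{dc,c} / a_{dc,F}`, `n_ic ↦ a_ic a_{dc,F} / (a_iF a_{dc,c})` (`exists_Psi`); both are well
defined because `[I₃ | A] = diag(λ) · [I₃ | 𝟙 | n] · diag(λ⁻¹ ⊕ 1 ⊕ μ)` makes corresponding minors
unit multiples of each other (`exists_unit_factor`), and they are mutually inverse on generators
(`nonempty_ringEquiv`). [cite: Hu2021, Thm. 9.3, p. 64; Lafforgue2003, Thm. I.11] -/
theorem stub_torusSplitting (p : ℕ) (κ' : Type) [Fintype κ'] [DecidableEq κ'] (d : κ' → Fin 3)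
    (Γ0 : Set (Fin 3 → Fin 3 ⊕ (Unit ⊕ κ'))) :
    Nonempty (StratumRing' p (Unit ⊕ κ') (designatedSels κ' d) Γ0 ≃+*
      TorusRing (Fin 3 ⊕ κ') (NormRing p κ' d Γ0)) := by
  obtain ⟨π, hπ⟩ : ∃ π : MvPolynomial (Fin 3 × (Unit ⊕ κ')) (ZMod p) →+*
      StratumRing' p (Unit ⊕ κ') (designatedSels κ' d) Γ0,
      π = (algebraMap _ _).comp (Ideal.Quotient.mk (Ideal.span (minor' p (Unit ⊕ κ') '' Γ0))) :=
    ⟨_, rfl⟩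
  obtain ⟨ι, hι⟩ : ∃ ι : MvPolynomial (Fin 3 ⊕ κ') (NormRing p κ' d Γ0) →+*
      TorusRing (Fin 3 ⊕ κ') (NormRing p κ' d Γ0), ι = algebraMap _ _ := ⟨_, rfl⟩
  obtain ⟨h0, hF, hdes⟩ := TorusSplitting.units_S p κ' d Γ0 π hπ
  obtain ⟨hιu, hJ, hnu⟩ := TorusSplitting.units_L p κ' d Γ0 ι hι
  obtain ⟨Φ, hΦF, hΦc⟩ := TorusSplitting.exists_Phi p κ' d Γ0 π hπ _ hJ
    (fun i => hιu (Sum.inl i)) (fun c => hιu (Sum.inr c))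
  obtain ⟨Ψ, hΨ1, hΨ2, hΨ3⟩ := TorusSplitting.exists_Psi p κ' d Γ0 ι hι π h0 hF hdes
  exact TorusSplitting.nonempty_ringEquiv d
    (fun f g h1 h2 => TorusSplitting.ringHom_ext_S p _ _ Γ0 π hπ fun ij => by
      rcases ij with ⟨i, ⟨⟩ | c⟩
      exacts [h1 i, h2 i c])
    (fun f g h1 h2 h3 => TorusSplitting.ringHom_ext_L p κ' d Γ0 ι hι (fun ic => h1 ic.1 ic.2)
      fun t => by
        rcases t with i | c
        exacts [h2 i, h3 c])
    (fun i => hιu _) (fun c => hιu _) hnu hΦF hΦc hΨ1 hΨ2 hΨ3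

end Summit.ResolutionOfSingularities.ResolutionOfSingularities.Theorems.UniversalCells

end
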